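import Literature.Geometry.Riemannian.ColdingMinicozziEntropyInvariance

/-!
# Values of the Colding–Minicozzi entropy: Stone's constants for shrinking spheres and cylinders

The entropy `λ` (`gaussianEntropy`, `ColdingMinicozziEntropy.lean`) of the generalized
self-shrinking cylinders `S^k_{√(2k)} × ℝ^{n-k} ⊂ ℝ^{n+1}` is the threshold scale of the
low-entropy mean curvature flow literature (Colding–Ilmanen–Minicozzi–White 2013, Bernstein–Wang
2016, Chodosh–Choi–Mantoulidis–Schulze). This file provides

* `sphereEntropy k : ℝ` — **Stone's constant** `Λ_k = |S^k| · (k/(2πe))^{k/2}`,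
  `|S^k| = 2π^{(k+1)/2}/Γ((k+1)/2)` the area of the unit `k`-sphere, i.e. the elementary value of
  the Gaussian area `F_{0,1}(S^k_{√(2k)}) = (4π)^{-k/2} e^{-2k/4} |S^k| (2k)^{k/2}` of the
  self-shrinking `k`-sphere; PROVED closed forms `sphereEntropy_one : Λ₁ = √(2π/e)` (`≈ 1.5203`)
  and `sphereEntropy_two : Λ₂ = 4/e` (`≈ 1.4715`), the two values printed in Colding–Minicozzi
  2012, Remark 1.7 ("the density of `S²` is `4/e ≈ 1.47`, and the density of `S¹ × R` is
  `√(2π/e) ≈ 1.52`"); numerically `Λ₃ = 2π²(3/(2πe))^{3/2} ≈ 1.4531`, `Λ₄ = 32/(3e²) ≈ 1.4436`,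
  `Λ_k ↓ √2`;
* `shrinkingCylinder n k ⊆ EuclideanSpace ℝ (Fin (n+1))` — the generalized cylinder
  `S^k_{√(2k)} × ℝ^{n-k} = {x | x₀² + ⋯ + x_k² = 2k}` (round factor in the FIRST `k+1`
  coordinates; Bernstein–Wang 2016, (4.1), put it in the last ones — the same set up to a
  coordinate permutation, an isometry, under which `λ` is invariant by
  `gaussianEntropy_image_isometryEquiv`), with `shrinkingCylinder_self`
  (`k = n`: the sphere `S^n_{√(2n)}`) and `shrinkingCylinder_four_one`
  (`= {y | y 0 ^ 2 + y 1 ^ 2 = 2}`, the literal threshold set of route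
  `SmoothPoincare4/EntropyLadder`);
* ONE named fact `Stone1994_cylinderEntropy`: `λ(S^k_{√(2k)} × ℝ^{n-k}) = Λ_k` for
  `1 ≤ k ≤ n` — Stone's computation of the Gaussian density of shrinking spheres and cylinders
  (Stone 1994, Appendix A), which IS their entropy because the entropy of a self-shrinker with
  polynomial volume growth is achieved by `F_{0,1}` (Colding–Minicozzi 2012, §7.2, Lemma 7.10;
  Bernstein–Wang 2016, §4: "By [CM], `λ_n = λ[Sⁿ] = F[Sⁿ]`") and `λ(Σ × ℝ) = λ(Σ)`
  (Colding–Ilmanen–Minicozzi–White 2013, Introduction); with its proved corollaries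
  `Stone1994_cylinderEntropy.sphere` (`λ(S^k_{√(2k)}) = Λ_k`), `.entropyLadderThreshold`
  (`λ₄ {y | y₀² + y₁² = 2} = √(2π/e)` in `ℝ⁵`) and `.sphere_of_pos` (every round `k`-sphere of
  `ℝ^{k+1}` has entropy `Λ_k`, by the translation/dilation invariance proved in
  `ColdingMinicozziEntropyInvariance.lean`).

Not here: the ordering `2 > Λ₁ > 3/2 > Λ₂ > ⋯ > Λ_n > ⋯ > 1` for all `n` (Stone 1994;
Bernstein–Wang 2016, (4.2)) beyond the closed forms above; the sharp lower bound
`λ(Σ) ≥ Λ_n` for closed hypersurfaces (Bernstein–Wang 2016, Thm. 1.1).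

## References

* A. Stone, *A density function and the structure of singularities of the mean curvature flow*,
  Calc. Var. PDE 2 (1994) 443–480, Appendix A (densities of shrinking spheres and cylinders;
  paywalled here, values as reported by the next three sources). [Stone1994]
* T. H. Colding, W. P. Minicozzi II, *Generic mean curvature flow I; generic singularities*,
  Ann. of Math. 175 (2012) 755–833, Remark 1.7, §7.2 Lemma 7.10. [ColdingMinicozzi2012]
* T. H. Colding, T. Ilmanen, W. P. Minicozzi II, B. White, *The round sphere minimizes entropy
  among closed self-shrinkers*, J. Differential Geom. 95 (2013) 53–69, Introduction
  ("`λ(S¹) = √(2π/e) ≈ 1.5203 > λ(S²) = 4/e ≈ 1.4715 > λ(S³) > ⋯ > 1 = λ(ℝⁿ)`. Moreover, a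
  simple computation shows that `λ(Σ × R) = λ(Σ)`"). [ColdingIlmanenMinicozziWhite2013]
* J. Bernstein, L. Wang, *A sharp lower bound for the entropy of closed hypersurfaces up to
  dimension six*, Invent. Math. 206 (2016) 601–627, §4 (4.1)–(4.2). [BernsteinWang2016]
-/

noncomputable section

open MeasureTheory MeasureTheory.Measure Set
open scoped ENNReal NNReal Topology Pointwise RealInnerProductSpace

namespace Literature.Geometry.Riemannian

/-! ### Stone's constants -/

/-- **Stone's constant** `Λ_k = |S^k| · (k/(2πe))^{k/2}` with `|S^k| = 2π^{(k+1)/2}/Γ((k+1)/2)`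
the area of the unit round `k`-sphere: the Gaussian area
`F_{0,1}(S^k_{√(2k)}) = (4π)^{-k/2} ∫_{S^k_{√(2k)}} e^{-|x|²/4} = (4π)^{-k/2} e^{-k/2} (2k)^{k/2} |S^k|`
of the self-shrinking `k`-sphere of radius `√(2k)`, which is the entropy of `S^k` and of the
cylinders `S^k × ℝ^{n-k}` (Stone 1994, Appendix A; Colding–Minicozzi 2012, Remark 1.7:
`Λ₂ = 4/e ≈ 1.47`, `Λ₁ = √(2π/e) ≈ 1.52`). For `k = 0` the value is the junk `2`
(`0^0 = 1`, `|S⁰| = 2`). [cite: ColdingMinicozzi2012, Remark 1.7] -/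
def sphereEntropy (k : ℕ) : ℝ :=
  2 * Real.pi ^ (((k : ℝ) + 1) / 2) / Real.Gamma (((k : ℝ) + 1) / 2) *
    ((k : ℝ) / (2 * Real.pi * Real.exp 1)) ^ ((k : ℝ) / 2)

/-- `Λ_k > 0` for `k ≥ 1`. [folklore] -/
theorem sphereEntropy_pos {k : ℕ} (hk : 1 ≤ k) : 0 < sphereEntropy k := by
  unfold sphereEntropy
  have hk' : (0 : ℝ) < k := by exact_mod_cast hk
  have hΓ : 0 < Real.Gamma (((k : ℝ) + 1) / 2) := Real.Gamma_pos_of_pos (by positivity)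
  positivity

/-- **`Λ₁ = √(2π/e)`** (`≈ 1.5203`), the entropy of the circle and of the cylinders
`S¹ × ℝ^{n-1}` (Colding–Minicozzi 2012, Remark 1.7: "the density of `S¹ × R` is
`√(2π/e) ≈ 1.52`"). [cite: ColdingMinicozzi2012, Remark 1.7] -/
theorem sphereEntropy_one : sphereEntropy 1 = Real.sqrt (2 * Real.pi / Real.exp 1) := by
  unfold sphereEntropy
  have h1 : (((1 : ℕ) : ℝ) + 1) / 2 = 1 := by norm_num
  have h2 : ((1 : ℕ) : ℝ) / 2 = 1 / 2 := by norm_num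
  rw [h1, h2, Real.rpow_one, Real.Gamma_one, div_one, ← Real.sqrt_eq_rpow, Nat.cast_one,
    show 2 * Real.pi / Real.exp 1 = (2 * Real.pi) ^ 2 * (1 / (2 * Real.pi * Real.exp 1)) by
      field_simp,
    Real.sqrt_mul (sq_nonneg _), Real.sqrt_sq (by positivity)]

/-- **`Λ₂ = 4/e`** (`≈ 1.4715`), the entropy of the `2`-sphere and of the cylinders
`S² × ℝ^{n-2}` (Colding–Minicozzi 2012, Remark 1.7: "the density of `S²` is `4/e ≈ 1.47`").
[cite: ColdingMinicozzi2012, Remark 1.7] -/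
theorem sphereEntropy_two : sphereEntropy 2 = 4 / Real.exp 1 := by
  unfold sphereEntropy
  have h1 : (((2 : ℕ) : ℝ) + 1) / 2 = 1 / 2 + 1 := by norm_num
  have h2 : ((2 : ℕ) : ℝ) / 2 = 1 := by norm_num
  have hπ : Real.sqrt Real.pi ≠ 0 := by positivity
  rw [h1, h2, Real.rpow_one, Real.Gamma_add_one (by norm_num), Real.Gamma_one_half_eq,
    Real.rpow_add Real.pi_pos, Real.rpow_one, ← Real.sqrt_eq_rpow, Nat.cast_ofNat]
  field_simp
  ring

/-- `1 < Λ₂`, i.e. `e < 4`. [folklore] -/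
theorem one_lt_sphereEntropy_two : 1 < sphereEntropy 2 := by
  rw [sphereEntropy_two, one_lt_div (Real.exp_pos 1)]
  have := Real.exp_one_lt_d9
  linarith

/-- **`Λ₂ < Λ₁`** (`4/e < √(2π/e)`, i.e. `8 < πe`): the cylinder `S¹ × ℝ^{n-1}` has larger
entropy than `S² × ℝ^{n-2}` (Stone 1994; Colding–Ilmanen–Minicozzi–White 2013, Introduction:
"`λ(S¹) = √(2π/e) ≈ 1.5203 > λ(S²) = 4/e ≈ 1.4715`"). [cite: ColdingIlmanenMinicozziWhite2013, Introduction] -/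
theorem sphereEntropy_two_lt_sphereEntropy_one : sphereEntropy 2 < sphereEntropy 1 := by
  rw [sphereEntropy_two, sphereEntropy_one, Real.lt_sqrt (by positivity)]
  have he := Real.exp_one_gt_d9
  have he' := Real.exp_one_lt_d9
  have hπ := Real.pi_gt_d2
  rw [div_pow, div_lt_div_iff₀ (by positivity) (by positivity)]
  nlinarith [Real.exp_pos 1]

/-! ### The generalized shrinking cylinders -/

/-- The **generalized self-shrinking cylinder** `S^k_{√(2k)} × ℝ^{n-k} ⊂ ℝ^{n+1}`:
`{x | x₀² + ⋯ + x_k² = 2k}`, the round factor of radius `√(2k)` in the first `k+1` coordinates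
(Colding–Minicozzi 2012, p. 758: "cylindrical products `S^k × R^{n-k}` (where the `S^k` has radius
`√(-2kt)`)", here at `t = -1`; Bernstein–Wang 2016, (4.1), with the round factor in the last
coordinates instead). For `k = 0` it degenerates to the hyperplane `{x₀ = 0}` (`S⁰` of radius
`0`; excluded from the named fact below), for `k = n` it is the sphere `S^n_{√(2n)}`
(`shrinkingCylinder_self`).
[cite: ColdingMinicozzi2012, p. 758] -/
def shrinkingCylinder (n k : ℕ) : Set (EuclideanSpace ℝ (Fin (n + 1))) :=
  {x | ∑ i : Fin (n + 1), (if (i : ℕ) ≤ k then x i ^ 2 else 0) = 2 * k}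

/-- Membership in the generalized cylinder (definitional). [cite: ColdingMinicozzi2012, p. 758] -/
theorem mem_shrinkingCylinder {n k : ℕ} {x : EuclideanSpace ℝ (Fin (n + 1))} :
    x ∈ shrinkingCylinder n k ↔ ∑ i : Fin (n + 1), (if (i : ℕ) ≤ k then x i ^ 2 else 0) = 2 * k :=
  Iff.rfl

/-- For `k = n` the generalized cylinder is the self-shrinking sphere `S^n_{√(2n)}`.
[cite: ColdingMinicozzi2012, p. 758] -/
theorem shrinkingCylinder_self (n : ℕ) :
    shrinkingCylinder n n = Metric.sphere (0 : EuclideanSpace ℝ (Fin (n + 1))) (Real.sqrt (2 * n)) := by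
  ext x
  simp only [mem_shrinkingCylinder, Fin.is_le, if_true, Metric.mem_sphere, dist_zero_right,
    EuclideanSpace.norm_eq, Real.norm_eq_abs, sq_abs]
  rw [Real.sqrt_inj (Finset.sum_nonneg fun i _ => sq_nonneg _) (by positivity)]

/-- **The threshold set of route `SmoothPoincare4/EntropyLadder`**: in `ℝ⁵`,
`S¹_{√2} × ℝ³ = {y | y 0 ^ 2 + y 1 ^ 2 = 2}`. [cite: ColdingMinicozzi2012, p. 758] -/
theorem shrinkingCylinder_four_one :
    shrinkingCylinder 4 1 = {y : EuclideanSpace ℝ (Fin 5) | y 0 ^ 2 + y 1 ^ 2 = 2} := by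
  show shrinkingCylinder 4 1 = {y : EuclideanSpace ℝ (Fin (4 + 1)) | y 0 ^ 2 + y 1 ^ 2 = 2}
  ext y
  simp only [mem_shrinkingCylinder, Set.mem_setOf_eq, Fin.sum_univ_succ, Fin.sum_univ_zero,
    Fin.val_zero, Fin.val_succ, Fin.succ_zero_eq_one, Nat.cast_one, mul_one]
  norm_num

/-! ### Stone's values (named fact) and corollaries -/

/-- **Stone's entropy values for the generalized cylinders** (named fact): for `1 ≤ k ≤ n`,
`λ(S^k_{√(2k)} × ℝ^{n-k}) = Λ_k = |S^k| (k/(2πe))^{k/2}`, i.e.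
`gaussianEntropy n (shrinkingCylinder n k) = sphereEntropy k`; in particular
`λ(S¹ × ℝ^{n-1}) = √(2π/e) ≈ 1.5203`, `λ(S² × ℝ^{n-2}) = 4/e ≈ 1.4715`, `λ(S³ × ℝ^{n-3}) ≈ 1.4531`,
`λ(S⁴ × ℝ^{n-4}) ≈ 1.4436`. Assembled from: Stone's computation of the Gaussian density
`F_{0,1}` of the shrinking spheres and cylinders (Stone 1994, Appendix A; values restated in
Colding–Minicozzi 2012, Remark 1.7, and Colding–Ilmanen–Minicozzi–White 2013, Introduction);
the entropy of a self-shrinker with polynomial volume growth that does not split off a line is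
attained exactly at `(x₀,t₀) = (0,1)`, so `λ(S^k) = F_{0,1}(S^k_{√(2k)})` (Colding–Minicozzi 2012,
§7.2, Lemma 7.10; Bernstein–Wang 2016, §4: "`λ_n = λ[Sⁿ] = F[Sⁿ]`"); and `λ(Σ × ℝ) = λ(Σ)`
(Colding–Ilmanen–Minicozzi–White 2013, Introduction). The area measure of these smooth
hypersurfaces is `μHE[n]⌊Σ`, the measure used by `gaussianEntropy`.
[cite: ColdingIlmanenMinicozziWhite2013, Introduction] -/
def Stone1994_cylinderEntropy : Prop :=
  ∀ n k : ℕ, 1 ≤ k → k ≤ n →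
    gaussianEntropy n (shrinkingCylinder n k) = ENNReal.ofReal (sphereEntropy k)

/-- Corollary (`k = n`): the entropy of the self-shrinking sphere `S^n_{√(2n)} ⊂ ℝ^{n+1}` is
`Λ_n` (Stone 1994; Colding–Minicozzi 2012, Lemma 7.10). [cite: ColdingMinicozzi2012, Lemma 7.10] -/
theorem Stone1994_cylinderEntropy.sphere (h : Stone1994_cylinderEntropy) {n : ℕ} (hn : 1 ≤ n) :
    gaussianEntropy n (Metric.sphere (0 : EuclideanSpace ℝ (Fin (n + 1))) (Real.sqrt (2 * n))) =
      ENNReal.ofReal (sphereEntropy n) := by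
  rw [← shrinkingCylinder_self]
  exact h n n hn le_rfl

/-- Corollary: **the threshold of route `SmoothPoincare4/EntropyLadder`** —
`λ₄({y ∈ ℝ⁵ | y₀² + y₁² = 2}) = λ(S¹ × ℝ³) = √(2π/e) ≈ 1.5203`.
[cite: ColdingIlmanenMinicozziWhite2013, Introduction] -/
theorem Stone1994_cylinderEntropy.entropyLadderThreshold (h : Stone1994_cylinderEntropy) :
    gaussianEntropy 4 {y : EuclideanSpace ℝ (Fin 5) | y 0 ^ 2 + y 1 ^ 2 = 2} =
      ENNReal.ofReal (Real.sqrt (2 * Real.pi / Real.exp 1)) := by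
  rw [← shrinkingCylinder_four_one, ← sphereEntropy_one]
  exact h 4 1 le_rfl (by norm_num)

/-- Corollary: **every round `n`-sphere of `ℝ^{n+1}` has entropy `Λ_n`** (`n ≥ 1`, any centre,
any radius `r > 0`), by the proved translation and dilation invariance of `λ`
(Colding–Minicozzi 2012, p. 760) applied to `.sphere`. [cite: ColdingMinicozzi2012, Lemma 7.10] -/
theorem Stone1994_cylinderEntropy.sphere_of_pos (h : Stone1994_cylinderEntropy) {n : ℕ}
    (hn : 1 ≤ n) (c : EuclideanSpace ℝ (Fin (n + 1))) {r : ℝ} (hr : 0 < r) :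
    gaussianEntropy n (Metric.sphere c r) = ENNReal.ofReal (sphereEntropy n) := by
  have hn' : (0 : ℝ) < Real.sqrt (2 * n) := Real.sqrt_pos.2 (by positivity)
  have hρ : r / Real.sqrt (2 * n) ≠ 0 := (div_pos hr hn').ne'
  have hs : Metric.sphere c r = c +ᵥ ((r / Real.sqrt (2 * n)) •
      Metric.sphere (0 : EuclideanSpace ℝ (Fin (n + 1))) (Real.sqrt (2 * n))) := by
    rw [smul_sphere' hρ, smul_zero, Real.norm_eq_abs, abs_of_pos (div_pos hr hn'),
      div_mul_cancel₀ _ hn'.ne', Metric.vadd_sphere, vadd_eq_add, add_zero]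
  rw [hs, gaussianEntropy_vadd, gaussianEntropy_smul hρ, h.sphere hn]

end Literature.Geometry.Riemannian
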